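/-
Copyright: the b2b-balaban T⁴-continuum CRUX team, row NE7b leaf lineage `t4-ne7b-formalise-leaf-05` (gen 161). Project licence.
-/
import Summits.QuantumFields.BalabanUV.T4Continuum.Spine.NE7b.BlockAverageSemigroup
import Summits.QuantumFields.BalabanUV.T4Continuum.Spine.NE7b.BlockAverageUpperBound

/-!
# THE RE-ENTRANT INVARIANT OF THE FREE SCALAR HARD FLOW ON PRINT's TORUS — «the level's effective form IS a one-shot effective
# form `Q⁺_{(s,P)}`» is BORN by the first hard step, PRESERVED by every further hard step with the canonical rescaling `L^{2−d}`,
# and CARRIES the level-free letters `R ≤ V ≤ γ₁(d)·R`, `Q′_L g = 0 ⟹ (2∕L²)‖g‖² ≤ V g g`, `∃!` next critical section — so the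
# RECURSIVE `k`-step Gaussian tower (SECS form) has the SAME letters AT EVERY LEVEL, no product of per-level constants
# (row NE7b, node U5c; [folklore] over this lineage's BASG ∕ BAUB ∕ BACS ∕ BAKF ∕ BADD and leaf-03's QFM BY NAME)

Cell `pub-balaban`, sub-cell `t4`, spine estimate NE7b (`T4WeightBudget.RelWeightBound`; the cell's OWN estimate — NOT PRINTED in
[Bałaban 1983–89], NOT PROVED).  Crux-route work under `Spine/NE7b/` by a row leaf (`t4-ne7b-formalise-leaf-05` gen 161) under FREEZE (0)'s
crux-prover clause; the eighth file of this lineage's hard-flow packet (BADD, BAKF, BACS, BAEC, BAIP, BAUB, BASG).  NOTHING of Bałaban's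
is asserted: the inputs are the typed (1.20) block average `B5Block118.QsOp`, the (1.4)∕(1.21) difference operator `B5Action121.GradOp`, the
Literature constant `B5Ineq167UpperZd.gamma1` BY NAME, and the kernel theorems of the packet.  No `T4Continuum/Support` leaf typed; no
`def`; zero `sorry`.

WHY (located).  Leaf-06's SECS (`…SupEquationTowerSections.tower_eq_sections`) books the `k`-step tower HONESTLY as a recursion whose
composite letter is a PRODUCT `∏_{j<k} N_j` of per-level constants («no control» — PRICING-NE7b v134 F795); BASG (`…BlockAverageSemigroup`)
showed for the free scalar flow that two hard steps are one (print's (1.16) at the level of critical sections and effective forms), and the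
OWNER's word on it (W-ne7bp1-g115-9) names the use: «the torus-side reason SOS∕SECS's product of per-level constants collapses».  This file
is that collapse AS A RE-ENTRANT INVARIANT, in the shape SIS∕`towerStep` have for the equation-map tower: a predicate on ONE level's
effective form that the first step creates, every step preserves, and that by itself yields the letters — so an induction over any
number of levels (the consumer's `Nat.rec`, any carrier bookkeeping) never multiplies constants.  The predicate is «`V` on `Tor P` is
the effective (Schur, constrained-minimum) form `Q⁺_{(s,P)} = Q_{(s,P)}.bilinearComp G G` of the ONE-SHOT fine form of some side `s` along
a critical section `G` of `Q′_s`» — written out as an explicit conjunction each time (no `def`).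

WHAT IS PROVED ([folklore]; every `d`, every `L, s ≥ 1`, every torus `P`; `E_s = EuclideanSpace ℝ (Tor (fine s P))`,
`F = EuclideanSpace ℝ (Tor P)`; all operators are abstract CLMs pinned by the packet's coordinate characterisations VERBATIM):
* §1 `fine_dot_eq_smul_unit_dot₂` (the level-`(L,P)` fine matrix is `(L²∕L^d)·` the unit Dirichlet matrix of `Tor (fine L P)` — BILINEAR,
  BACS §1 had the diagonal), `fineForm_eq_smul_unitForm` (the same for the CLM forms: `Q_{(L,P)} = (L²∕L^d) • R′`).
* §2 THE READING IS BORN AND PRESERVED.  **`oneShot_start`**: `H` a critical section of `Q′_L` for the unit form `R′` of `Tor (fine L P)`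
  ⟹ `(L²∕L^d) • R′.bilinearComp H H` is read at side `L` (it IS `Q_{(L,P)}.bilinearComp H H`); `exists_start_section` ∕
  `start_section_unique` (that `H` exists and is unique — BACS at level `(L, P)`, BAKF's kernel floor).  **`oneShot_step`**: `V′` on
  `Tor (fine L P)` read at side `s` over `fine L P`, `H` a critical section of `Q′_L : Tor (fine L P) → Tor P` for `V′` ⟹
  `(L²∕L^d) • V′.bilinearComp H H` is read at side `L·s` over `P` — BASG `critical_comp` + `effectiveForm_eq_smul_twoStep` BY NAME
  (`Q⁺_{(Ls,P)} = L^{2−d}·(Q⁺_{(s, fine L P)})⁺`).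
* §3 THE LETTERS OF A READING, LEVEL-FREE.  **`letters_of_oneShot`**: `V` read at side `s` over `P` ⟹ `V` symmetric, `0 ≤ V g g`,
  `R g g ≤ V g g` (BADD `transported_dominates_of_section`, `γ₀ = 1`) and `V g g ≤ gamma1 d · R g g` (BAUB `critical_le_gamma1`,
  `γ₁(d) = 2 + 8d²·36^d` BY NAME) — print's (1.67) both halves for the level's effective form, constants free of `s`, `P`, `L`;
  **`nextStep_of_oneShot`**: `V` read over `fine L P₀` ⟹ the next-kernel floor `Q′_L g = 0 ⟹ (2∕L²)‖g‖² ≤ V g g` (BACS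
  `criticalFlow_nextFloor`), a critical section of `Q′_L` for `V` EXISTS (QFM `exists_propagator`, BAKF's block-constant section) and is
  UNIQUE (QFM `propagator_unique`) — the recursion continues, with the same letters, at every level.
* §4 `twoSteps_letters`: the invariant run twice by hand — after two recursive hard steps the level form obeys (1.67) with `(1, γ₁(d))`,
  NOT `(1, γ₁(d)²)`; toy.

NOT HERE (honest): the ℕ-indexed packaging over a level family `N (j+1) = fine L (N j)` (the consumer's `Nat.rec`; the carrier
bookkeeping `Tor (N (j+1)) ≃ Tor (fine L (N j))` is a `B5Composition116.recast`); the interacting ∕ non-linear tower (leaf-03's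
`…HardStepSemigroup` §4; BAUB §4's sandwich is one step); the VECTOR law (1.17); `U ≠ 1`; `ℓ²(ℤ^d)`; anything of Bałaban's small-field
action ((A3) ∕ (A1c), NC-NE7b-α UNRULED); `γ₁(d)` by value is useless (PRICING F794) — only its LEVEL-INDEPENDENCE is the content here.
BY-NAME EFFECT ON THE WALL: NONE (the free scalar tower's letters are uniform in the level; the wall is (R2)).  NE7b NOT PRINTED ∕ NOT
PROVED; spine PROVED 0∕9; rung (B)+1 on a FINITE torus — NOT infinite volume, NOT the mass gap, NOT Clay.  HONEST DEPENDENCY: continuum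
YM on T⁴ ⇐ BetaPertH ∧ nine spine estimates (0∕9 proved); BetaPertH ⇐ (D1) ∧ (D4) ∧ CAP+tail; G-an2-4 gates asym, D1 and NE2∕3∕4.
-/

set_option autoImplicit false

namespace Summit.QuantumFields.BalabanUV.T4Continuum.NE7b.BlockAverageTowerLetters

open Matrix WithLp Finset
open Literature.MathematicalPhysics.QuantumFieldTheory.Balaban1983to89
open B5Prop11Plancherel (Tor fine unitVec)
open B5Action121 (GradOp)
open B5Block118 (QsOp)
open B5RealFields (reM)
open B5Ineq167UpperZd (gamma1)
open Summit.QuantumFields.BalabanUV.T4Continuum.NE7b.MatrixFormJunction (exists_form exists_map)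
open Summit.QuantumFields.BalabanUV.T4Continuum.NE7b.QuadraticFibreMinimiser (exists_propagator propagator_unique)
open Summit.QuantumFields.BalabanUV.T4Continuum.NE7b.BlockAverageDirichletDomination
  (reM_GradOp_mulVec transported_dominates_of_section)
open Summit.QuantumFields.BalabanUV.T4Continuum.NE7b.BlockAverageKernelFloor (exists_blockConstant_section kernelFloor_CLM)
open Summit.QuantumFields.BalabanUV.T4Continuum.NE7b.BlockAverageCriticalSection
  (exists_criticalSection fineForm_symm fineForm_nonneg criticalFlow_nextFloor)
open Summit.QuantumFields.BalabanUV.T4Continuum.NE7b.BlockAverageUpperBound (critical_le_gamma1)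
open Summit.QuantumFields.BalabanUV.T4Continuum.NE7b.BlockAverageSemigroup
  (dot_smul_transpose_mul exists_sitesMap critical_comp effectiveForm_eq_smul_twoStep)

variable {d : ℕ} (L : ℕ) [NeZero L]

/-! ## §1. The level-`(L, P)` fine form is `L^{2−d}` times the unit Dirichlet form of the fine torus — bilinear version -/

section Scaling

variable (P : Fin d → ℕ) [hP : ∀ μ, NeZero (P μ)]

/-- **`u ⬝ (A_L w) = (L²∕L^d)·(u ⬝ (S₁ w))`** with `A_L = η^d·(re ∂^η)ᵀ(re ∂^η)` (`η = L⁻¹`, `∂^η = L·∂₁`) the level-`(L,P)` fine Dirichlet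
matrix and `S₁ = (re ∂₁)ᵀ(re ∂₁)` the unit-difference Dirichlet matrix of `Tor (fine L P)` — the canonical rescaling `η^{d−2}` of a scalar
field, BILINEAR (BACS `fine_dot_eq_smul_unit_dot` is the diagonal `u = w`). [folklore] -/
theorem fine_dot_eq_smul_unit_dot₂ (u w : Tor (fine L P) → ℝ) :
    u ⬝ᵥ (((1 / (L : ℝ) ^ d) • ((reM (GradOp (fine L P) (L : ℂ)))ᵀ * reM (GradOp (fine L P) (L : ℂ)))) *ᵥ w)
      = (L : ℝ) ^ 2 / (L : ℝ) ^ d * (u ⬝ᵥ (((reM (GradOp (fine L P) 1))ᵀ * reM (GradOp (fine L P) 1)) *ᵥ w)) := by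
  have h1 : ((L : ℝ) : ℂ) = (L : ℂ) := Complex.ofReal_natCast _
  have e1 : (reM (GradOp (fine L P) 1))ᵀ * reM (GradOp (fine L P) 1)
      = (1 : ℝ) • ((reM (GradOp (fine L P) ((1 : ℝ) : ℂ)))ᵀ * reM (GradOp (fine L P) ((1 : ℝ) : ℂ))) := by
    rw [Complex.ofReal_one, one_smul]
  rw [e1, ← h1, dot_smul_transpose_mul, dot_smul_transpose_mul, one_mul, Fintype.sum_prod_type, Fintype.sum_prod_type,
    Finset.mul_sum, Finset.mul_sum]
  refine Finset.sum_congr rfl fun x _ => ?_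
  rw [Finset.mul_sum, Finset.mul_sum]
  refine Finset.sum_congr rfl fun μ _ => ?_
  simp only [reM_GradOp_mulVec]
  have hL : (L : ℝ) ≠ 0 := by exact_mod_cast NeZero.ne L
  field_simp

/-- **`Q_{(L,P)} = (L²∕L^d) • R′`** for the CLM forms pinned by the two matrices. [folklore] -/
theorem fineForm_eq_smul_unitForm
    {Q R' : EuclideanSpace ℝ (Tor (fine L P)) →L[ℝ] EuclideanSpace ℝ (Tor (fine L P)) →L[ℝ] ℝ}
    (hQ : ∀ x y, Q x y = ofLp x ⬝ᵥ
      (((1 / (L : ℝ) ^ d) • ((reM (GradOp (fine L P) (L : ℂ)))ᵀ * reM (GradOp (fine L P) (L : ℂ)))) *ᵥ ofLp y))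
    (hR' : ∀ x y, R' x y = ofLp x ⬝ᵥ (((reM (GradOp (fine L P) 1))ᵀ * reM (GradOp (fine L P) 1)) *ᵥ ofLp y)) :
    Q = ((L : ℝ) ^ 2 / (L : ℝ) ^ d) • R' := by
  ext x y
  rw [hQ, _root_.smul_apply, _root_.smul_apply, smul_eq_mul, hR']
  exact fine_dot_eq_smul_unit_dot₂ L P _ _

omit hP in
/-- `0 < L²∕L^d`. -/
theorem sq_div_pow_pos : (0 : ℝ) < (L : ℝ) ^ 2 / (L : ℝ) ^ d := by
  have hL : (0 : ℝ) < L := by exact_mod_cast Nat.pos_of_ne_zero (NeZero.ne L)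
  positivity

end Scaling

/-! ## §2. THE ONE-SHOT READING is born by the first hard step and preserved by every further one

The READING of a form `V` on `F = EuclideanSpace ℝ (Tor P)` AT SIDE `s` is the conjunction (written out verbatim below, no `def`):
`Qₒ` is the level-`(s,P)` fine form and `Dₒ = re Q′_s` in coordinates, `G` is a critical section of `Dₒ` for `Qₒ` (`Dₒ (G g) = g`,
`Qₒ (G g) κ = 0` on `ker Dₒ`), and `V = Qₒ.bilinearComp G G`. -/

section Start

variable (P : Fin d → ℕ) [hP : ∀ μ, NeZero (P μ)]

/-- **THE READING IS BORN BY THE FIRST HARD STEP.**  `R′` the unit Dirichlet form of `Tor (fine L P)`, `D = re Q′_L`, `H` a critical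
section of `D` for `R′` ⟹ the rescaled transported form `V = (L²∕L^d) • R′.bilinearComp H H` is read at side `L` over `P`: it IS
`Q_{(L,P)}.bilinearComp H H` with `H` critical for `Q_{(L,P)} = (L²∕L^d) • R′` (§1). [folklore] -/
theorem oneShot_start
    {R' : EuclideanSpace ℝ (Tor (fine L P)) →L[ℝ] EuclideanSpace ℝ (Tor (fine L P)) →L[ℝ] ℝ}
    {D : EuclideanSpace ℝ (Tor (fine L P)) →L[ℝ] EuclideanSpace ℝ (Tor P)}
    (hR' : ∀ x y, R' x y = ofLp x ⬝ᵥ (((reM (GradOp (fine L P) 1))ᵀ * reM (GradOp (fine L P) 1)) *ᵥ ofLp y))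
    (hD : ∀ x, ofLp (D x) = reM (QsOp L P) *ᵥ ofLp x)
    {H : EuclideanSpace ℝ (Tor P) →L[ℝ] EuclideanSpace ℝ (Tor (fine L P))}
    (hH : ∀ g, D (H g) = g) (hHo : ∀ g κ, D κ = 0 → R' (H g) κ = 0)
    {V : EuclideanSpace ℝ (Tor P) →L[ℝ] EuclideanSpace ℝ (Tor P) →L[ℝ] ℝ}
    (hV : V = ((L : ℝ) ^ 2 / (L : ℝ) ^ d) • R'.bilinearComp H H) :
    ∃ (Qₒ : EuclideanSpace ℝ (Tor (fine L P)) →L[ℝ] EuclideanSpace ℝ (Tor (fine L P)) →L[ℝ] ℝ)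
      (Dₒ : EuclideanSpace ℝ (Tor (fine L P)) →L[ℝ] EuclideanSpace ℝ (Tor P))
      (G : EuclideanSpace ℝ (Tor P) →L[ℝ] EuclideanSpace ℝ (Tor (fine L P))),
      (∀ x y, Qₒ x y = ofLp x ⬝ᵥ
        (((1 / (L : ℝ) ^ d) • ((reM (GradOp (fine L P) (L : ℂ)))ᵀ * reM (GradOp (fine L P) (L : ℂ)))) *ᵥ ofLp y)) ∧
      (∀ x, ofLp (Dₒ x) = reM (QsOp L P) *ᵥ ofLp x) ∧
      (∀ g, Dₒ (G g) = g) ∧ (∀ g κ, Dₒ κ = 0 → Qₒ (G g) κ = 0) ∧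
      V = Qₒ.bilinearComp G G := by
  classical
  subst hV
  obtain ⟨Qₒ, hQₒ⟩ := exists_form (ι := Tor (fine L P))
    ((1 / (L : ℝ) ^ d) • ((reM (GradOp (fine L P) (L : ℂ)))ᵀ * reM (GradOp (fine L P) (L : ℂ))))
  have hQR : Qₒ = ((L : ℝ) ^ 2 / (L : ℝ) ^ d) • R' := fineForm_eq_smul_unitForm L P hQₒ hR'
  refine ⟨Qₒ, D, H, hQₒ, hD, hH, fun g κ hκ => ?_, ?_⟩
  · rw [hQR, _root_.smul_apply, _root_.smul_apply, hHo g κ hκ, smul_zero]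
  · rw [hQR]
    ext g g'
    simp only [ContinuousLinearMap.bilinearComp_apply, _root_.smul_apply]

/-- THE FIRST CRITICAL SECTION EXISTS: a continuous linear right inverse of `re Q′_L` with `R′`-orthogonal values (BACS
`exists_criticalSection` at level `(L, P)`; `R′`-orthogonality is `Q_{(L,P)}`-orthogonality by §1). [folklore] -/
theorem exists_start_section
    {R' : EuclideanSpace ℝ (Tor (fine L P)) →L[ℝ] EuclideanSpace ℝ (Tor (fine L P)) →L[ℝ] ℝ}
    {D : EuclideanSpace ℝ (Tor (fine L P)) →L[ℝ] EuclideanSpace ℝ (Tor P)}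
    (hR' : ∀ x y, R' x y = ofLp x ⬝ᵥ (((reM (GradOp (fine L P) 1))ᵀ * reM (GradOp (fine L P) 1)) *ᵥ ofLp y))
    (hD : ∀ x, ofLp (D x) = reM (QsOp L P) *ᵥ ofLp x) :
    ∃ H : EuclideanSpace ℝ (Tor P) →L[ℝ] EuclideanSpace ℝ (Tor (fine L P)),
      (∀ g, D (H g) = g) ∧ (∀ g κ, D κ = 0 → R' (H g) κ = 0) := by
  classical
  obtain ⟨Qₒ, hQₒ⟩ := exists_form (ι := Tor (fine L P))
    ((1 / (L : ℝ) ^ d) • ((reM (GradOp (fine L P) (L : ℂ)))ᵀ * reM (GradOp (fine L P) (L : ℂ))))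
  obtain ⟨H, hH, hHo⟩ := exists_criticalSection L P hQₒ hD
  refine ⟨H, hH, fun g κ hκ => ?_⟩
  have h := hHo g κ hκ
  rw [fineForm_eq_smul_unitForm L P hQₒ hR', _root_.smul_apply, _root_.smul_apply, smul_eq_zero] at h
  exact h.resolve_left (sq_div_pow_pos (d := d) L).ne'

/-- THE FIRST CRITICAL SECTION IS UNIQUE (QFM `propagator_unique` with BAKF's kernel floor `2∕L²` of `R′` on `ker Q′_L`). [folklore] -/
theorem start_section_unique
    {R' : EuclideanSpace ℝ (Tor (fine L P)) →L[ℝ] EuclideanSpace ℝ (Tor (fine L P)) →L[ℝ] ℝ}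
    {D : EuclideanSpace ℝ (Tor (fine L P)) →L[ℝ] EuclideanSpace ℝ (Tor P)}
    (hR' : ∀ x y, R' x y = ofLp x ⬝ᵥ (((reM (GradOp (fine L P) 1))ᵀ * reM (GradOp (fine L P) 1)) *ᵥ ofLp y))
    (hD : ∀ x, ofLp (D x) = reM (QsOp L P) *ᵥ ofLp x)
    {H H' : EuclideanSpace ℝ (Tor P) →L[ℝ] EuclideanSpace ℝ (Tor (fine L P))}
    (hH : ∀ g, D (H g) = g) (hHo : ∀ g κ, D κ = 0 → R' (H g) κ = 0)
    (hH' : ∀ g, D (H' g) = g) (hH'o : ∀ g κ, D κ = 0 → R' (H' g) κ = 0) : H = H' := by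
  have hm : (0 : ℝ) < 2 / (L : ℝ) ^ 2 := by
    have hL : (0 : ℝ) < L := by exact_mod_cast Nat.pos_of_ne_zero (NeZero.ne L)
    positivity
  exact propagator_unique hm (fun κ hκ => kernelFloor_CLM L P hR' hD κ hκ) hH hHo hH' hH'o

end Start

section Step

variable (P : Fin d → ℕ) [hP : ∀ μ, NeZero (P μ)] (s : ℕ) [NeZero s]

/-- **THE READING IS PRESERVED BY A HARD STEP, WITH PRINT's RESCALING.**  `V′` on `Tor (fine L P)` read at side `s` over `fine L P`
(`V′ = Qₒ′.bilinearComp G′ G′`, `G′` critical for the level-`(s, fine L P)` fine form and `re Q′_s`), `D = re Q′_L : Tor (fine L P) → Tor P`,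
`H` a critical section of `D` for `V′` ⟹ `V = (L²∕L^d) • V′.bilinearComp H H` is read at side `L·s` over `P`, along the composite section
`S ∘ G′ ∘ H` (`S` the site map of `B5Composition116.sites`) — BASG `critical_comp` and `effectiveForm_eq_smul_twoStep` BY NAME. [folklore] -/
theorem oneShot_step
    {V' : EuclideanSpace ℝ (Tor (fine L P)) →L[ℝ] EuclideanSpace ℝ (Tor (fine L P)) →L[ℝ] ℝ}
    {Qₒ' : EuclideanSpace ℝ (Tor (fine s (fine L P))) →L[ℝ] EuclideanSpace ℝ (Tor (fine s (fine L P))) →L[ℝ] ℝ}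
    {Dₒ' : EuclideanSpace ℝ (Tor (fine s (fine L P))) →L[ℝ] EuclideanSpace ℝ (Tor (fine L P))}
    {G' : EuclideanSpace ℝ (Tor (fine L P)) →L[ℝ] EuclideanSpace ℝ (Tor (fine s (fine L P)))}
    (hQₒ' : ∀ x y, Qₒ' x y = ofLp x ⬝ᵥ (((1 / (s : ℝ) ^ d) •
      ((reM (GradOp (fine s (fine L P)) (s : ℂ)))ᵀ * reM (GradOp (fine s (fine L P)) (s : ℂ)))) *ᵥ ofLp y))
    (hDₒ' : ∀ x, ofLp (Dₒ' x) = reM (QsOp s (fine L P)) *ᵥ ofLp x)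
    (hG' : ∀ g, Dₒ' (G' g) = g) (hG'o : ∀ g κ, Dₒ' κ = 0 → Qₒ' (G' g) κ = 0) (hV' : V' = Qₒ'.bilinearComp G' G')
    {D : EuclideanSpace ℝ (Tor (fine L P)) →L[ℝ] EuclideanSpace ℝ (Tor P)}
    (hD : ∀ x, ofLp (D x) = reM (QsOp L P) *ᵥ ofLp x)
    {H : EuclideanSpace ℝ (Tor P) →L[ℝ] EuclideanSpace ℝ (Tor (fine L P))}
    (hH : ∀ g, D (H g) = g) (hHo : ∀ g κ, D κ = 0 → V' (H g) κ = 0)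
    {V : EuclideanSpace ℝ (Tor P) →L[ℝ] EuclideanSpace ℝ (Tor P) →L[ℝ] ℝ}
    (hV : V = ((L : ℝ) ^ 2 / (L : ℝ) ^ d) • V'.bilinearComp H H) :
    ∃ (Qₒ : EuclideanSpace ℝ (Tor (fine (L * s) P)) →L[ℝ] EuclideanSpace ℝ (Tor (fine (L * s) P)) →L[ℝ] ℝ)
      (Dₒ : EuclideanSpace ℝ (Tor (fine (L * s) P)) →L[ℝ] EuclideanSpace ℝ (Tor P))
      (G : EuclideanSpace ℝ (Tor P) →L[ℝ] EuclideanSpace ℝ (Tor (fine (L * s) P))),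
      (∀ x y, Qₒ x y = ofLp x ⬝ᵥ (((1 / ((L * s : ℕ) : ℝ) ^ d) •
        ((reM (GradOp (fine (L * s) P) ((L * s : ℕ) : ℂ)))ᵀ * reM (GradOp (fine (L * s) P) ((L * s : ℕ) : ℂ)))) *ᵥ ofLp y)) ∧
      (∀ x, ofLp (Dₒ x) = reM (QsOp (L * s) P) *ᵥ ofLp x) ∧
      (∀ g, Dₒ (G g) = g) ∧ (∀ g κ, Dₒ κ = 0 → Qₒ (G g) κ = 0) ∧
      V = Qₒ.bilinearComp G G := by
  classical
  subst hV hV'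
  obtain ⟨Qₒ, hQₒ⟩ := exists_form (ι := Tor (fine (L * s) P)) ((1 / ((L * s : ℕ) : ℝ) ^ d) •
    ((reM (GradOp (fine (L * s) P) ((L * s : ℕ) : ℂ)))ᵀ * reM (GradOp (fine (L * s) P) ((L * s : ℕ) : ℂ))))
  obtain ⟨Dₒ, hDₒ⟩ := exists_map (ι := Tor (fine (L * s) P)) (κ := Tor P) (reM (QsOp (L * s) P))
  obtain ⟨S, hS⟩ := exists_sitesMap L s P
  obtain ⟨hsec, horth⟩ := critical_comp L s P hQₒ hDₒ hQₒ' hDₒ' hD hS hG' hG'o hH hHo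
  have hsec' : ∀ g, Dₒ ((S.comp (G'.comp H)) g) = g := fun g => by simpa using hsec g
  have horth' : ∀ g κ, Dₒ κ = 0 → Qₒ ((S.comp (G'.comp H)) g) κ = 0 := fun g κ hκ => by simpa using horth g κ hκ
  exact ⟨Qₒ, Dₒ, S.comp (G'.comp H), hQₒ, hDₒ, hsec', horth',
    (effectiveForm_eq_smul_twoStep L s P hQₒ hDₒ hQₒ' hDₒ' hD hS hG' hG'o hH hHo hsec' horth').symm⟩

end Step

/-! ## §3. THE LETTERS OF A READING — level-free -/

section Letters

variable (P : Fin d → ℕ) [hP : ∀ μ, NeZero (P μ)] (s : ℕ) [NeZero s]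

/-- **PRINT's (1.67), BOTH HALVES, FOR ANY LEVEL READ AS ONE SHOT.**  `V` on `Tor P` read at side `s`, `R` the unit Dirichlet form of
`Tor P` ⟹ `V` is symmetric and positive, `R g g ≤ V g g` (BADD `transported_dominates_of_section`, `γ₀ = 1`) and
`V g g ≤ gamma1 d · R g g` (BAUB `critical_le_gamma1`) — constants free of `s`, `P`, `L` and of the number of steps that produced `V`.
[cite: Balaban1984PropagatorsI, (1.67) p.29] for the shape; [folklore] for this scalar torus statement. -/
theorem letters_of_oneShot
    {V : EuclideanSpace ℝ (Tor P) →L[ℝ] EuclideanSpace ℝ (Tor P) →L[ℝ] ℝ}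
    {Qₒ : EuclideanSpace ℝ (Tor (fine s P)) →L[ℝ] EuclideanSpace ℝ (Tor (fine s P)) →L[ℝ] ℝ}
    {Dₒ : EuclideanSpace ℝ (Tor (fine s P)) →L[ℝ] EuclideanSpace ℝ (Tor P)}
    {G : EuclideanSpace ℝ (Tor P) →L[ℝ] EuclideanSpace ℝ (Tor (fine s P))}
    (hQₒ : ∀ x y, Qₒ x y = ofLp x ⬝ᵥ
      (((1 / (s : ℝ) ^ d) • ((reM (GradOp (fine s P) (s : ℂ)))ᵀ * reM (GradOp (fine s P) (s : ℂ)))) *ᵥ ofLp y))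
    (hDₒ : ∀ x, ofLp (Dₒ x) = reM (QsOp s P) *ᵥ ofLp x)
    (hG : ∀ g, Dₒ (G g) = g) (hGo : ∀ g κ, Dₒ κ = 0 → Qₒ (G g) κ = 0) (hV : V = Qₒ.bilinearComp G G)
    {R : EuclideanSpace ℝ (Tor P) →L[ℝ] EuclideanSpace ℝ (Tor P) →L[ℝ] ℝ}
    (hR : ∀ g h, R g h = ofLp g ⬝ᵥ (((reM (GradOp P 1))ᵀ * reM (GradOp P 1)) *ᵥ ofLp h)) :
    (∀ g h, V g h = V h g) ∧ (∀ g, 0 ≤ V g g) ∧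
      (∀ g, R g g ≤ V g g) ∧ (∀ g, V g g ≤ gamma1 d * R g g) := by
  subst hV
  refine ⟨fun g h => ?_, fun g => ?_, fun g => transported_dominates_of_section s P hQₒ hR hDₒ hG g,
    fun g => critical_le_gamma1 s P hQₒ hR hDₒ hG hGo g⟩
  · simp only [ContinuousLinearMap.bilinearComp_apply]
    exact fineForm_symm s P hQₒ _ _
  · simp only [ContinuousLinearMap.bilinearComp_apply]
    exact fineForm_nonneg s P hQₒ _

variable (P₀ : Fin d → ℕ) [hP₀ : ∀ μ, NeZero (P₀ μ)]

/-- **THE RECURSION CONTINUES WITH THE SAME LETTERS.**  `V` on `Tor (fine L P₀)` read at side `s` over `fine L P₀`, `D = re Q′_L :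
Tor (fine L P₀) → Tor P₀` ⟹ (i) the next-kernel floor `D g = 0 ⟹ (2∕L²)‖g‖² ≤ V g g` (BACS `criticalFlow_nextFloor`: no `s`, no volume,
no `d`), (ii) a critical section `H` of `D` for `V` EXISTS (QFM `exists_propagator` with BAKF's block-constant right inverse), (iii) it is
UNIQUE (QFM `propagator_unique`) — so §2's `oneShot_step` applies again at the next level. [folklore] -/
theorem nextStep_of_oneShot
    {V : EuclideanSpace ℝ (Tor (fine L P₀)) →L[ℝ] EuclideanSpace ℝ (Tor (fine L P₀)) →L[ℝ] ℝ}
    {Qₒ : EuclideanSpace ℝ (Tor (fine s (fine L P₀))) →L[ℝ] EuclideanSpace ℝ (Tor (fine s (fine L P₀))) →L[ℝ] ℝ}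
    {Dₒ : EuclideanSpace ℝ (Tor (fine s (fine L P₀))) →L[ℝ] EuclideanSpace ℝ (Tor (fine L P₀))}
    {G : EuclideanSpace ℝ (Tor (fine L P₀)) →L[ℝ] EuclideanSpace ℝ (Tor (fine s (fine L P₀)))}
    (hQₒ : ∀ x y, Qₒ x y = ofLp x ⬝ᵥ (((1 / (s : ℝ) ^ d) •
      ((reM (GradOp (fine s (fine L P₀)) (s : ℂ)))ᵀ * reM (GradOp (fine s (fine L P₀)) (s : ℂ)))) *ᵥ ofLp y))
    (hDₒ : ∀ x, ofLp (Dₒ x) = reM (QsOp s (fine L P₀)) *ᵥ ofLp x)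
    (hG : ∀ g, Dₒ (G g) = g) (hV : V = Qₒ.bilinearComp G G)
    {R' : EuclideanSpace ℝ (Tor (fine L P₀)) →L[ℝ] EuclideanSpace ℝ (Tor (fine L P₀)) →L[ℝ] ℝ}
    (hR' : ∀ g h, R' g h = ofLp g ⬝ᵥ (((reM (GradOp (fine L P₀) 1))ᵀ * reM (GradOp (fine L P₀) 1)) *ᵥ ofLp h))
    {D : EuclideanSpace ℝ (Tor (fine L P₀)) →L[ℝ] EuclideanSpace ℝ (Tor P₀)}
    (hD : ∀ g, ofLp (D g) = reM (QsOp L P₀) *ᵥ ofLp g) :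
    (∀ g, D g = 0 → 2 / (L : ℝ) ^ 2 * ‖g‖ ^ 2 ≤ V g g) ∧
      (∃ H : EuclideanSpace ℝ (Tor P₀) →L[ℝ] EuclideanSpace ℝ (Tor (fine L P₀)),
        (∀ g, D (H g) = g) ∧ (∀ g κ, D κ = 0 → V (H g) κ = 0)) ∧
      (∀ H H' : EuclideanSpace ℝ (Tor P₀) →L[ℝ] EuclideanSpace ℝ (Tor (fine L P₀)),
        (∀ g, D (H g) = g) → (∀ g κ, D κ = 0 → V (H g) κ = 0) →
        (∀ g, D (H' g) = g) → (∀ g κ, D κ = 0 → V (H' g) κ = 0) → H = H') := by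
  subst hV
  have hfl : ∀ g, D g = 0 → 2 / (L : ℝ) ^ 2 * ‖g‖ ^ 2 ≤ (Qₒ.bilinearComp G G) g g :=
    fun g hg => criticalFlow_nextFloor s L P₀ hQₒ hR' hDₒ hG hD g hg
  have hm : (0 : ℝ) < 2 / (L : ℝ) ^ 2 := by
    have hL : (0 : ℝ) < L := by exact_mod_cast Nat.pos_of_ne_zero (NeZero.ne L)
    positivity
  obtain ⟨T₀, -, hT₀⟩ := exists_blockConstant_section L P₀ hD
  obtain ⟨H, hH, hHo, -⟩ := exists_propagator (Q := Qₒ.bilinearComp G G) hT₀ hm hfl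
  exact ⟨hfl, ⟨H, hH, hHo⟩, fun H₁ H₂ h₁ h₁o h₂ h₂o => propagator_unique hm hfl h₁ h₁o h₂ h₂o⟩

end Letters

/-! ## §4. Two recursive hard steps by hand: the letters do NOT multiply -/

section TwoSteps

variable (P₀ : Fin d → ℕ) [hP₀ : ∀ μ, NeZero (P₀ μ)]

/-- **TWO RECURSIVE HARD STEPS CARRY `(1, γ₁(d))`, NOT `(1, γ₁(d)²)`.**  Start on `Tor (fine L (fine L P₀))` with its unit Dirichlet form
`R₂`; first step: `H₁` critical for `(R₂, re Q′_L)`, `V₁ = (L²∕L^d) • R₂.bilinearComp H₁ H₁` on `Tor (fine L P₀)`; second step: `H₀`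
critical for `(V₁, re Q′_L)`, `V₀ = (L²∕L^d) • V₁.bilinearComp H₀ H₀` on `Tor P₀`.  Then BOTH `V₁` and `V₀` obey (1.67) with the SAME
constants against their own unit Dirichlet forms `R₁`, `R₀`: `R₁ ≤ V₁ ≤ gamma1 d·R₁` and `R₀ ≤ V₀ ≤ gamma1 d·R₀` (§2 twice, §3 twice;
the naive route — BAUB §4's sandwich applied to the second step with `V₁`'s letters as input — would give `gamma1 d · gamma1 d`). [folklore] -/
theorem twoSteps_letters
    {R₂ : EuclideanSpace ℝ (Tor (fine L (fine L P₀))) →L[ℝ] EuclideanSpace ℝ (Tor (fine L (fine L P₀))) →L[ℝ] ℝ}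
    {R₁ : EuclideanSpace ℝ (Tor (fine L P₀)) →L[ℝ] EuclideanSpace ℝ (Tor (fine L P₀)) →L[ℝ] ℝ}
    {R₀ : EuclideanSpace ℝ (Tor P₀) →L[ℝ] EuclideanSpace ℝ (Tor P₀) →L[ℝ] ℝ}
    (hR₂ : ∀ x y, R₂ x y = ofLp x ⬝ᵥ
      (((reM (GradOp (fine L (fine L P₀)) 1))ᵀ * reM (GradOp (fine L (fine L P₀)) 1)) *ᵥ ofLp y))
    (hR₁ : ∀ x y, R₁ x y = ofLp x ⬝ᵥ (((reM (GradOp (fine L P₀) 1))ᵀ * reM (GradOp (fine L P₀) 1)) *ᵥ ofLp y))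
    (hR₀ : ∀ x y, R₀ x y = ofLp x ⬝ᵥ (((reM (GradOp P₀ 1))ᵀ * reM (GradOp P₀ 1)) *ᵥ ofLp y))
    {D₁ : EuclideanSpace ℝ (Tor (fine L (fine L P₀))) →L[ℝ] EuclideanSpace ℝ (Tor (fine L P₀))}
    {D₀ : EuclideanSpace ℝ (Tor (fine L P₀)) →L[ℝ] EuclideanSpace ℝ (Tor P₀)}
    (hD₁ : ∀ x, ofLp (D₁ x) = reM (QsOp L (fine L P₀)) *ᵥ ofLp x)
    (hD₀ : ∀ x, ofLp (D₀ x) = reM (QsOp L P₀) *ᵥ ofLp x)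
    {H₁ : EuclideanSpace ℝ (Tor (fine L P₀)) →L[ℝ] EuclideanSpace ℝ (Tor (fine L (fine L P₀)))}
    (hH₁ : ∀ g, D₁ (H₁ g) = g) (hH₁o : ∀ g κ, D₁ κ = 0 → R₂ (H₁ g) κ = 0)
    {V₁ : EuclideanSpace ℝ (Tor (fine L P₀)) →L[ℝ] EuclideanSpace ℝ (Tor (fine L P₀)) →L[ℝ] ℝ}
    (hV₁ : V₁ = ((L : ℝ) ^ 2 / (L : ℝ) ^ d) • R₂.bilinearComp H₁ H₁)
    {H₀ : EuclideanSpace ℝ (Tor P₀) →L[ℝ] EuclideanSpace ℝ (Tor (fine L P₀))}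
    (hH₀ : ∀ g, D₀ (H₀ g) = g) (hH₀o : ∀ g κ, D₀ κ = 0 → V₁ (H₀ g) κ = 0)
    {V₀ : EuclideanSpace ℝ (Tor P₀) →L[ℝ] EuclideanSpace ℝ (Tor P₀) →L[ℝ] ℝ}
    (hV₀ : V₀ = ((L : ℝ) ^ 2 / (L : ℝ) ^ d) • V₁.bilinearComp H₀ H₀) :
    (∀ g, R₁ g g ≤ V₁ g g ∧ V₁ g g ≤ gamma1 d * R₁ g g) ∧
      (∀ g, R₀ g g ≤ V₀ g g ∧ V₀ g g ≤ gamma1 d * R₀ g g) := by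
  obtain ⟨Q₁, E₁, G₁, hQ₁, hE₁, hG₁, hG₁o, hV₁'⟩ := oneShot_start L (fine L P₀) hR₂ hD₁ hH₁ hH₁o hV₁
  obtain ⟨-, -, hlo₁, hhi₁⟩ := letters_of_oneShot (fine L P₀) L hQ₁ hE₁ hG₁ hG₁o hV₁' hR₁
  obtain ⟨Q₀, E₀, G₀, hQ₀, hE₀, hG₀, hG₀o, hV₀'⟩ :=
    oneShot_step L P₀ L hQ₁ hE₁ hG₁ hG₁o hV₁' hD₀ hH₀ hH₀o hV₀
  obtain ⟨-, -, hlo₀, hhi₀⟩ := letters_of_oneShot P₀ (L * L) hQ₀ hE₀ hG₀ hG₀o hV₀' hR₀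
  exact ⟨fun g => ⟨hlo₁ g, hhi₁ g⟩, fun g => ⟨hlo₀ g, hhi₀ g⟩⟩

/-- Toy: the naive two-step ceiling `γ₁(d)²` against the semigroup ceiling `γ₁(d)` at `d = 4`: `gamma1 4 = 2 + 8·16·36⁴ = 214 990 850`,
its square exceeds `4.6 × 10¹⁶`; and the rescaling factor `L²∕L^d = 1∕4` at `L = 2`, `d = 4`. -/
example : (2 : ℝ) + 8 * 4 ^ 2 * 36 ^ 4 = 214990850 ∧ (214990850 : ℝ) ^ 2 > 4.6e16 ∧ (2 : ℝ) ^ 2 / (2 : ℝ) ^ 4 = 1 / 4 := by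
  norm_num

end TwoSteps

end Summit.QuantumFields.BalabanUV.T4Continuum.NE7b.BlockAverageTowerLetters
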